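import Mathlib
import Literature.NumberTheory.LFunctions.Zhang2022.Section14Eq146Assembly
import Literature.NumberTheory.LFunctions.Zhang2022.Section14U017Generic
import HarnessLib

/-!
# Zhang (2022) §14 (14.6): assembly from the two (14.8)-type legs at the modulus `D₂k`

Topic `Literature/NumberTheory/LFunctions/Zhang2022` (Landau–Siegel audit tree; verdict-neutral).
Y. Zhang, *Discrete mean estimates and the Landau–Siegel zero*, arXiv:2211.02515v1 (2022)
[Zhang2022LandauSiegel] — **an unrefereed manuscript under adjudication**; ZHANG-L discharge lane,
WP14, helper under the leaf `Skeleton.Prop141` (node `Z22:(14.6)`, GAP row G-adj2-4). Nothing here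
asserts Proposition 14.1, (14.6), Theorems 1–2 of the manuscript, or anything about Landau–Siegel zeros.

(14.6) (p. 78, tex L3915): "for `D = D₁D₂`, `D₁ > 1`, `Σ_{p∼P} χ(p)𝒮(D₁,D₂;p) ≪ P²D^{1/2−c}`", whose
printed proof is one sentence (p. 79, tex L3966–L3969): "The proof of (14.6) is analogous … the main
terms involved in the proof of (14.5) do not appear." The tree already holds the two bookkeeping
halves of that sentence: `Typed.Sec14.eq146_of_nonprincipal` (libA, `Section14Eq146Assembly`: (14.6) ⇐
the (14.8)-shaped majorant of the non-principal `θ (mod D₂k)` is `≤ C·P²·D^{−c}`) and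
`Typed.Sec14.nonprincipal₂_le_reindex` (libA, `Section14U017Generic`: that majorant, re-indexed by
conductor `r` and primitive `θ' (mod r)`, `D₂k = hr`, exactly as §14 u017 does for (14.5)). This
THEOREM-ONLY file composes them and splits the conductor range as the manuscript does for (14.8)
("for `1 < r < D³` … Lemma 5.6; for `D³ ≤ r < 2DP₄` … the large sieve inequality", p. 79, tex L3960–L3963):

* `eq146_of_legs₂` — **(14.6) `Typed.Sec14.Eq146` follows from the two leg estimates at level `D₂`**:
  the re-indexed majorant (weight `χ(p)`, coefficients `κ*(D₁d·)`, factor `D₂/(φ(hr)h√r)`, primitive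
  `θ' (mod r)` with `θ'↑ ≠ χ↑`) restricted to `r < D³`, resp. to `r ≥ D³` (`2 ≤ r ≤ 2D₂P₄`), each
  `≤ C·P²·D^{−c}` for all large `D` under (A) ⇒ `Eq146` (constants `c = min(c₁,c₂)`,
  `C = |B|(|C₁| + |C₂|)`). The two hypotheses are the (14.6)-instances of the coefficient-generic
  (14.8) leg engines of the lane; they are stated inline (no new `Prop` definitions).

## References

* Y. Zhang, arXiv:2211.02515v1 (2022), §14 (14.6) p. 78, its proof sentence p. 79 (tex L3915,
  L3960–L3969), u016–u017 p. 79. [cite: Zhang2022LandauSiegel, §14 (14.6) pp. 78–79]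
-/

noncomputable section

open Complex Real

namespace Literature.NumberTheory.LFunctions.Zhang2022.Typed.Sec14

open Skeleton DirichletCharacter

/-- **(14.6) from the two (14.8)-type legs at the modulus `D₂k`.** If the re-indexed non-principal
majorant of `Σ_{p∼P} χ(p)𝒮(D₁,D₂;p)` (`nonprincipal₂_le_reindex`, weight `χ`, level `D₂`) is
`≤ C·P²·D^{−c}` on each of the two conductor ranges `2 ≤ r < D³` and `D³ ≤ r ≤ 2D₂P₄` ("for `1 < r < D³`
we use the Mellin transform, Lemma 5.4 (i) and Lemma 5.6; for `D³ ≤ r < 2DP₄` … the large sieve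
inequality", p. 79 — "the proof of (14.6) is analogous"), then **(14.6)** `Typed.Sec14.Eq146` holds
(via `eq146_of_nonprincipal`). [cite: Zhang2022LandauSiegel, §14 (14.6) proof p.79, tex L3960–L3969] -/
theorem eq146_of_legs₂
    (hleg1 : ∀ B : ℝ, ∃ c : ℝ, 0 < c ∧ ∃ C : ℝ, ForAllLarge fun D _ χ => AssumptionA D χ →
        ∀ κs : ℕ → ℂ, Eq141 B κs → ∀ D₁ D₂ : ℕ, D₁ * D₂ = D → 1 < D₁ →
          ∑ d ∈ Finset.Icc 1 ⌊2 * P4 D⌋₊, (d : ℝ)⁻¹ *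
            ∑ r ∈ (Finset.Icc 2 ⌊2 * (D₂ : ℝ) * P4 D⌋₊).filter (fun r => r < D ^ 3),
              ∑ h ∈ (Finset.Ico 1 ⌈bigP D / r⌉₊).filter (fun h => D₂ / Nat.gcd D₂ r ∣ h),
                (D₂ : ℝ) / ((Nat.totient (h * r) : ℝ) * h * Real.sqrt r) *
                  ∑ θ' ∈ finsetOf {θ' : DirichletCharacter ℂ r | θ'.IsPrimitive ∧
                      changeLevel (dvd_mul_left r D) θ' ≠ changeLevel (dvd_mul_right D r) χ},
                    ‖∑' l : ℕ, if Nat.Coprime l h then κs (D₁ * d * l) * θ' (l : ZMod r) *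
                        ∑ p ∈ primeWindow D, χ (p : ZMod D) * θ'⁻¹ (p : ZMod r) *
                          DeltaW D ((l : ℝ) / ((p : ℝ) * h * r)) else 0‖
            ≤ C * bigP D ^ 2 * (D : ℝ) ^ (-c))
    (hleg2 : ∀ B : ℝ, ∃ c : ℝ, 0 < c ∧ ∃ C : ℝ, ForAllLarge fun D _ χ => AssumptionA D χ →
        ∀ κs : ℕ → ℂ, Eq141 B κs → ∀ D₁ D₂ : ℕ, D₁ * D₂ = D → 1 < D₁ →
          ∑ d ∈ Finset.Icc 1 ⌊2 * P4 D⌋₊, (d : ℝ)⁻¹ *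
            ∑ r ∈ (Finset.Icc 2 ⌊2 * (D₂ : ℝ) * P4 D⌋₊).filter (fun r => ¬ r < D ^ 3),
              ∑ h ∈ (Finset.Ico 1 ⌈bigP D / r⌉₊).filter (fun h => D₂ / Nat.gcd D₂ r ∣ h),
                (D₂ : ℝ) / ((Nat.totient (h * r) : ℝ) * h * Real.sqrt r) *
                  ∑ θ' ∈ finsetOf {θ' : DirichletCharacter ℂ r | θ'.IsPrimitive ∧
                      changeLevel (dvd_mul_left r D) θ' ≠ changeLevel (dvd_mul_right D r) χ},
                    ‖∑' l : ℕ, if Nat.Coprime l h then κs (D₁ * d * l) * θ' (l : ZMod r) *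
                        ∑ p ∈ primeWindow D, χ (p : ZMod D) * θ'⁻¹ (p : ZMod r) *
                          DeltaW D ((l : ℝ) / ((p : ℝ) * h * r)) else 0‖
            ≤ C * bigP D ^ 2 * (D : ℝ) ^ (-c)) :
    Eq146 := by
  classical
  refine eq146_of_nonprincipal fun B => ?_
  obtain ⟨c₁, hc₁, C₁, h₁⟩ := hleg1 B
  obtain ⟨c₂, hc₂, C₂, h₂⟩ := hleg2 B
  obtain ⟨Dr, hre⟩ := nonprincipal₂_le_reindex
  obtain ⟨D₀, h12⟩ := h₁.and h₂
  refine ⟨min c₁ c₂, lt_min hc₁ hc₂, |B| * (|C₁| + |C₂|), max D₀ (max Dr 1),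
    fun D _ χ hD hq hp hA κs as hκ ha D₁ D₂ hD₁₂ hD₁ => ?_⟩
  have hD₀ : D₀ ≤ D := le_trans (le_max_left _ _) hD
  have hDr : Dr ≤ D := le_trans ((le_max_left _ _).trans (le_max_right _ _)) hD
  have hD1 : (1 : ℝ) ≤ D := by
    exact_mod_cast (le_trans ((le_max_right _ _).trans (le_max_right _ _)) hD : 1 ≤ D)
  have hD0 : (0 : ℝ) < D := by linarith
  obtain ⟨e1, e2⟩ := h12 D χ hD₀ hq hp
  have g1 := e1 hA κs hκ D₁ D₂ hD₁₂ hD₁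
  have g2 := e2 hA κs hκ D₁ D₂ hD₁₂ hD₁
  have gre := hre D hDr inferInstance χ hp as B ha.1 κs (fun p => χ (p : ZMod D)) D₁ D₂ hD₁₂ hD₁
  -- names for the re-indexed inner sums on an `r`-set
  set F : ℕ → ℕ → ℝ := fun d r =>
    ∑ h ∈ (Finset.Ico 1 ⌈bigP D / r⌉₊).filter (fun h => D₂ / Nat.gcd D₂ r ∣ h),
      (D₂ : ℝ) / ((Nat.totient (h * r) : ℝ) * h * Real.sqrt r) *
        ∑ θ' ∈ finsetOf {θ' : DirichletCharacter ℂ r | θ'.IsPrimitive ∧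
            changeLevel (dvd_mul_left r D) θ' ≠ changeLevel (dvd_mul_right D r) χ},
          ‖∑' l : ℕ, if Nat.Coprime l h then κs (D₁ * d * l) * θ' (l : ZMod r) *
              ∑ p ∈ primeWindow D, χ (p : ZMod D) * θ'⁻¹ (p : ZMod r) *
                DeltaW D ((l : ℝ) / ((p : ℝ) * h * r)) else 0‖ with hF
  have hF0 : ∀ d r, 0 ≤ F d r := by
    intro d r
    refine Finset.sum_nonneg fun h _ => mul_nonneg ?_ (Finset.sum_nonneg fun _ _ => norm_nonneg _)
    exact div_nonneg (Nat.cast_nonneg _)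
      (mul_nonneg (mul_nonneg (Nat.cast_nonneg _) (Nat.cast_nonneg _)) (Real.sqrt_nonneg _))
  set Rset : Finset ℕ := Finset.Icc 2 ⌊2 * (D₂ : ℝ) * P4 D⌋₊ with hRset
  set L₁ : ℝ := ∑ d ∈ Finset.Icc 1 ⌊2 * P4 D⌋₊, (d : ℝ)⁻¹ *
    ∑ r ∈ Rset.filter (fun r => r < D ^ 3), F d r with hL₁
  set L₂ : ℝ := ∑ d ∈ Finset.Icc 1 ⌊2 * P4 D⌋₊, (d : ℝ)⁻¹ *
    ∑ r ∈ Rset.filter (fun r => ¬ r < D ^ 3), F d r with hL₂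
  have hL₁0 : 0 ≤ L₁ := Finset.sum_nonneg fun d _ =>
    mul_nonneg (inv_nonneg.mpr (Nat.cast_nonneg _)) (Finset.sum_nonneg fun r _ => hF0 d r)
  have hL₂0 : 0 ≤ L₂ := Finset.sum_nonneg fun d _ =>
    mul_nonneg (inv_nonneg.mpr (Nat.cast_nonneg _)) (Finset.sum_nonneg fun r _ => hF0 d r)
  have hsplit : ∑ d ∈ Finset.Icc 1 ⌊2 * P4 D⌋₊, (d : ℝ)⁻¹ * ∑ r ∈ Rset, F d r = L₁ + L₂ := by
    rw [hL₁, hL₂, ← Finset.sum_add_distrib]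
    refine Finset.sum_congr rfl fun d _ => ?_
    rw [← mul_add, Finset.sum_filter_add_sum_filter_not]
  -- the two legs, with absolute values of the constants and the common exponent
  have hP2 : 0 ≤ bigP D ^ 2 := sq_nonneg _
  have hpow₁ : (D : ℝ) ^ (-c₁) ≤ (D : ℝ) ^ (-min c₁ c₂) :=
    Real.rpow_le_rpow_of_exponent_le hD1 (neg_le_neg (min_le_left c₁ c₂))
  have hpow₂ : (D : ℝ) ^ (-c₂) ≤ (D : ℝ) ^ (-min c₁ c₂) :=
    Real.rpow_le_rpow_of_exponent_le hD1 (neg_le_neg (min_le_right c₁ c₂))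
  have k1 : L₁ ≤ |C₁| * bigP D ^ 2 * (D : ℝ) ^ (-min c₁ c₂) :=
    calc L₁ ≤ C₁ * bigP D ^ 2 * (D : ℝ) ^ (-c₁) := by simpa only [hL₁, hF, hRset] using g1
      _ ≤ |C₁| * bigP D ^ 2 * (D : ℝ) ^ (-c₁) := by
          gcongr
          exact le_abs_self C₁
      _ ≤ |C₁| * bigP D ^ 2 * (D : ℝ) ^ (-min c₁ c₂) := by gcongr
  have k2 : L₂ ≤ |C₂| * bigP D ^ 2 * (D : ℝ) ^ (-min c₁ c₂) :=
    calc L₂ ≤ C₂ * bigP D ^ 2 * (D : ℝ) ^ (-c₂) := by simpa only [hL₂, hF, hRset] using g2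
      _ ≤ |C₂| * bigP D ^ 2 * (D : ℝ) ^ (-c₂) := by
          gcongr
          exact le_abs_self C₂
      _ ≤ |C₂| * bigP D ^ 2 * (D : ℝ) ^ (-min c₁ c₂) := by gcongr
  -- the re-indexing inequality, read with the names above
  have gre' : ∑ d ∈ Finset.Icc 1 ⌊2 * P4 D⌋₊, (d : ℝ)⁻¹ *
      ∑ k ∈ (Finset.Icc 1 ⌊2 * P4 D⌋₊).filter (fun k => Nat.Coprime k D₁),
        ‖as (d * k)‖ / ((Nat.totient (D₂ * k) : ℝ) * k) *
          ∑ θ ∈ finsetOf {θ : DirichletCharacter ℂ (D₂ * k) | θ ≠ 1},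
            ‖tauSum (D₂ * k) θ⁻¹‖ *
              ‖∑' l : ℕ, κs (D₁ * d * l) * θ (l : ZMod (D₂ * k)) *
                  ∑ p ∈ primeWindow D, χ (p : ZMod D) * θ⁻¹ (p : ZMod (D₂ * k)) *
                    DeltaW D ((l : ℝ) / ((D₂ : ℝ) * p * k))‖ ≤
      B * ∑ d ∈ Finset.Icc 1 ⌊2 * P4 D⌋₊, (d : ℝ)⁻¹ * ∑ r ∈ Rset, F d r := by
    simpa only [hF, hRset] using gre
  have hB0 : 0 ≤ B := (norm_nonneg _).trans (ha.1 0)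
  calc _ ≤ B * ∑ d ∈ Finset.Icc 1 ⌊2 * P4 D⌋₊, (d : ℝ)⁻¹ * ∑ r ∈ Rset, F d r := gre'
    _ = B * (L₁ + L₂) := by rw [hsplit]
    _ ≤ |B| * (L₁ + L₂) := mul_le_mul_of_nonneg_right (le_abs_self B) (add_nonneg hL₁0 hL₂0)
    _ ≤ |B| * (|C₁| * bigP D ^ 2 * (D : ℝ) ^ (-min c₁ c₂) +
          |C₂| * bigP D ^ 2 * (D : ℝ) ^ (-min c₁ c₂)) :=
        mul_le_mul_of_nonneg_left (add_le_add k1 k2) (abs_nonneg B)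
    _ = |B| * (|C₁| + |C₂|) * bigP D ^ 2 * (D : ℝ) ^ (-min c₁ c₂) := by ring

end Literature.NumberTheory.LFunctions.Zhang2022.Typed.Sec14
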